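import Literature.AlgebraicGeometry.ComplexMultiplication.CyclotomicFermatCMTypesOddTwoPrimeLevelSimple
import Literature.AlgebraicGeometry.ComplexMultiplication.CyclotomicFermatCMTypesBadOddCharacterCountExact
import HarnessLib

/-!
# Koblitz–Rohrlich at the two EXCEPTIONAL odd levels `N = 21` and `N = 39` (§2 Remark 2): the lattices `L_{1,4,16}` (mod `21`) and
# `L_{1,16,22}` (mod `39`) have stabiliser `W = H` of order `6` and `12`; the strong form of (∗) fails exactly there among odd two-prime levels

Layer `Literature/AlgebraicGeometry/ComplexMultiplication`, namespace `…ComplexMultiplication.CyclotomicFermatCMType`; sequel of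
`CyclotomicFermatCMTypesOddTwoPrimeLevelSimple` ((∗) and Theorems 1–2 at every odd two-prime level `N ∉ {21, 39}`) and
`CyclotomicFermatCMTypesBadOddCharacterCountExact` (`s(21) = 1/6`, `s(39) = 1/4`: the character-count hypothesis fails at `21`, `39`).
THEOREMS ONLY (no definition, no named fact, no `sorry`); the level-`21`/`39` facts are kernel computations (`decide`) on the tree's
`fermatCMType`.

THE SOURCE.  N. Koblitz, D. Rohrlich, *Simple factors in the Jacobian of a Fermat curve*, Canad. J. Math. **30** (1978) 1183–1205.
§1 (p. 1184): "Let `W_{r,s} = {w ∈ (ℤ/Mℤ)* : wH_{r,s} = H_{r,s}}`.  Then `W_{r,s}` is a subgroup of `(ℤ/Mℤ)*`, and `L_{r,s}` is simple if and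
only if `W_{r,s} = {1}`.  Suppose `W_{r,s} ≠ {1}`.  Then `L_{r,s}` is isogenous to a product of `|W_{r,s}|` isomorphic simple factors … These
factors have complex multiplication by an order of the fixed field of `W_{r,s}` and CM-type equal to `H_{r,s}/W_{r,s}`".  §2 REMARK 2
(p. 1193): "If `N` is odd and `3|N` … `s(21) = 1/6`, `s(39) = 1/4`. … When `N = 21, 39`, the non-obvious isogenies in the relatively prime
case all turn out to occur when `J_{r,s,t}` is isogenous to a product of elliptic curves.  In each case we can take `(r, s, t)` to be
`(1, ρ, ρ²)` where `ρ` is a cube root of `1 mod N`.  For `N = 21`, `J_{1,4,16}` is isogenous to the product of `6` copies of the same elliptic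
curve that occurs for `N = 7` and the triple `(1, 2, 4)`. … For `N = 39`, `J_{1,16,22}` is isogenous to a product of `12` copies of an elliptic
curve that does not occur as a simple factor for prime `N`."

WHAT IS PROVED (the residue-set content of these sentences; the isogeny to `E⁶` / `E¹²` itself — Shimura–Taniyama's factor count — is
NOT typed, see the honest column):

* §1 `N = 21`: `H_{1,4,16} = {1, 2, 4, 8, 11, 16}` (`fermatCMType_twentyOne_one_four_sixteen`); it is its own stabiliser —
  `wH = H ⟺ w ∈ H` for units `w` (`forall_mem_iff_mul_mem_iff_mem_twentyOne`), so `|W_{1,4,16}| = 6 = φ(21)/2`, against `|W| = 3` (`{1, ρ, ρ²}`)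
  at the levels of Theorem 2; `H_{1,4,16}` is the set of units of `ℤ/21` whose reduction mod `7` lies in `H_{1,2,4} = {1, 2, 4}`
  (`mem_fermatCMType_twentyOne_iff_mod_seven`: "the same elliptic curve that occurs for `N = 7` and the triple `(1, 2, 4)`" — the type is
  pulled back from level `7`); `H_{2,8,11} = H_{1,4,16}` although `{2, 8, 11} ≠ {1, 4, 16}` (`τ′ = 2τ`): **the strong form of (∗)
  (`H_{τ′} = H_τ ⟹ {τ′} = {τ}` for unit triples) FAILS at `21`** (`not_forall_fermatCMType_eq_imp_multiset_eq_twentyOne`); no abelian variety of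
  type `Φ_{(1,4,16)}` is simple (`not_isSimple_of_fermat_one_four_sixteen`).
* §2 `N = 39`: `H_{1,16,22} = {1, 2, 4, 5, 8, 10, 11, 16, 20, 22, 25, 32}` = its own stabiliser, `|W| = 12 = φ(39)/2` (EVERY unit is `±w`
  with `wH = H`); `H_{2,32,5} = H_{1,16,22}` with `{2, 32, 5} ≠ {1, 16, 22}`: the strong (∗) FAILS at `39`; non-simplicity.
* §3 **THE IFF CAPSTONES AT ODD TWO-PRIME LEVELS `N = pᵃqᵇ`** (`p ≠ q` odd primes, `a, b ≥ 1`):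
  `twelve_mul_card_bad_lt_totient_iff_oddTwoPrimes` — **`12·#S₀(N) < φ(N) ⟺ N ∉ {21, 39}`** (Remark 2's "precisely two values" at two-prime
  levels, both directions); `forall_fermatCMType_eq_iff_multiset_eq_iff_oddTwoPrimes` — **the strong (∗) holds for all unit triples modulo `N`
  iff `N ∉ {21, 39}`**.

## Honest column / NOT here

* "`J_{1,4,16}` is isogenous to the product of `6` copies of [an] elliptic curve" and the `12` copies at `39` are NOT typed as isogenies: that
  needs the identification of `Φ_{H}` with the type induced from the fixed field of `W` (K–R's Shimura–Taniyama citation [7], p. 1184) on the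
  tree's `cmTypeOfResidues`, not available by name; typed are `W = H`, `|W| = 6, 12`, the level-`7` pull-back description at `21`, and
  non-simplicity.  Likewise "the same elliptic curve" / "does not occur for prime `N`" (the CM fields `ℚ(√−7)`, `ℚ(√−39)`) are not typed.
* K–R's Theorem 1 (i) reads `H = H′ ⟺ {r,s,t} ∼ {r′,s′,t′}` with `∼` = unit multiple up to permutation; the tree's (∗) is the STRONG form
  `H′ = H ⟺ {r′,s′,t′} = {r,s,t}` (equivalent where `W ⊆ {1, ρ, ρ²}`, i.e. at every level of `…CoprimeSixLevelSimple` / `…OddTwoPrimeLevelSimple`);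
  §3's second iff is about the strong form.  In K–R's class form nothing fails at `21`, `39` among UNIT triples (their "non-obvious
  isogenies" there are with factors of LOWER level) — not typed.
* Only the two exceptional levels and odd two-prime levels; `decide` facts are stated for the specific triples `(1,4,16)`, `(2,8,11)`,
  `(1,16,22)`, `(2,32,5)`.
* No private declarations; every `decide` fact is stated for reuse.

## References

* [KoblitzRohrlich1978] N. Koblitz, D. Rohrlich, Canad. J. Math. 30 (1978) 1183–1205: §1 (p. 1184), Theorem 1 (p. 1185), §2 Remark 2 (p. 1193).
* [Shimura1998] G. Shimura, *Abelian Varieties with Complex Multiplication and Modular Functions*, §8.2 Prop. 26, §8.4 Example (1)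
  (through `CyclotomicCMTypeResidueSets`, `SimpleIffPrimitiveCMType`).

## Provenance

Cell `pub-hodgecm2` (COR-CM), literature seat `lit-deligne-3` gen 35 (claim KR78-EXCEPTIONAL; count-neutral, own lane).
-/

noncomputable section

open NumberField

namespace Literature.AlgebraicGeometry.ComplexMultiplication

open Literature.NumberTheory.ComplexMultiplication
open Literature.NumberTheory.LFunctions
open Literature.AlgebraicGeometry.HodgeTheory
open Literature.AlgebraicGeometry.Pohlmann1968 Literature.AlgebraicGeometry.Pohlmann1968.Cyclotomic

namespace CyclotomicFermatCMType

/-! ## §1 `N = 21`: `H_{1,4,16} = W_{1,4,16}` has order `6`; the strong (∗) fails -/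

section TwentyOne

/-- **`H_{1,4,16}` modulo `21`** ("we can take `(r, s, t)` to be `(1, ρ, ρ²)` where `ρ` is a cube root of `1 mod N`": `ρ = 4`):
`H_{1,4,16} = {1, 2, 4, 8, 11, 16}` (kernel computation). [cite: KoblitzRohrlich1978, §2 Remark 2 (p. 1193)] -/
theorem fermatCMType_twentyOne_one_four_sixteen : fermatCMType 21 1 4 16 = {1, 2, 4, 8, 11, 16} := by
  decide

/-- `H_{2,8,11} = H_{1,4,16}` modulo `21` (`(2, 8, 11) = 2·(1, 4, 16)`; kernel computation). [cite: KoblitzRohrlich1978, §2 Remark 2 (p. 1193)] -/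
theorem fermatCMType_twentyOne_two_eight_eleven : fermatCMType 21 2 8 11 = fermatCMType 21 1 4 16 := by
  decide

/-- **`W_{1,4,16} = H_{1,4,16}` modulo `21`**: a unit `w` satisfies `wH_{1,4,16} = H_{1,4,16}` iff `w ∈ H_{1,4,16}` — so `|W_{1,4,16}| = 6`, not
the `3` of the family `{1, ρ, ρ²}` (K–R: `L_{r,s}` "is isogenous to a product of `|W_{r,s}|` isomorphic simple factors"; here
`6·dim = φ(21)/2 = 6`, elliptic curves). Kernel computation. [cite: KoblitzRohrlich1978, §1 (p. 1184) and §2 Remark 2 (p. 1193)] -/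
theorem forall_mem_iff_mul_mem_iff_mem_twentyOne :
    ∀ w : ZMod 21, w.val.Coprime 21 →
      ((∀ x, x ∈ fermatCMType 21 1 4 16 ↔ w * x ∈ fermatCMType 21 1 4 16) ↔ w ∈ fermatCMType 21 1 4 16) := by
  rw [fermatCMType_twentyOne_one_four_sixteen]
  decide

/-- `|H_{1,4,16}| = |W_{1,4,16}| = 6 = φ(21)/2` modulo `21`. [cite: KoblitzRohrlich1978, §2 Remark 2 (p. 1193)] -/
theorem card_fermatCMType_twentyOne_one_four_sixteen : (fermatCMType 21 1 4 16).card = 6 ∧ Nat.totient 21 = 12 := by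
  refine ⟨by rw [fermatCMType_twentyOne_one_four_sixteen]; decide, ?_⟩
  rw [show (21 : ℕ) = 3 * 7 from rfl, Nat.totient_mul (by norm_num), Nat.totient_prime (by norm_num),
    Nat.totient_prime (by norm_num)]

/-- **"the same elliptic curve that occurs for `N = 7` and the triple `(1, 2, 4)`"**: `H_{1,4,16} ⊂ (ℤ/21)ˣ` is the pull-back of
`H_{1,2,4} = {1, 2, 4} ⊂ (ℤ/7)ˣ` — a unit `h` mod `21` lies in `H_{1,4,16}` iff its reduction mod `7` lies in `H_{1,2,4}` (so the CM type
`Φ_{(1,4,16)}` of `ℚ(ζ₂₁)` is induced from the type `Φ_{(1,2,4)}` of `ℚ(ζ₇)`, whose field of values is `ℚ(√−7)`). Kernel computation.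
[cite: KoblitzRohrlich1978, §2 Remark 2 (p. 1193)] -/
theorem mem_fermatCMType_twentyOne_iff_mod_seven (h : ZMod 21) :
    h ∈ fermatCMType 21 1 4 16 ↔ h.val.Coprime 21 ∧ ZMod.castHom (show 7 ∣ 21 by norm_num) (ZMod 7) h ∈ fermatCMType 7 1 2 4 := by
  have e7 : fermatCMType 7 1 2 4 = {1, 2, 4} := by decide
  rw [fermatCMType_twentyOne_one_four_sixteen, e7]
  revert h
  decide

/-- **The strong form of (∗) FAILS at `N = 21`**: there are unit triples `τ = (1, 4, 16)`, `τ′ = (2, 8, 11)` (sums `0`) with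
`H_{τ′} = H_τ` but `{2, 8, 11} ≠ {1, 4, 16}` — the hypothesis `12·#S₀(21) < φ(21)` of the odd-level theorem being unavailable (`s(21) = 1/6`).
[cite: KoblitzRohrlich1978, §2 Remark 2 (p. 1193)] -/
theorem not_forall_fermatCMType_eq_imp_multiset_eq_twentyOne :
    ¬∀ r s t r' s' t' : ZMod 21, IsUnit r → IsUnit s → IsUnit t → r + s + t = 0 →
      IsUnit r' → IsUnit s' → IsUnit t' → r' + s' + t' = 0 →
        fermatCMType 21 r' s' t' = fermatCMType 21 r s t → ({r', s', t'} : Multiset (ZMod 21)) = {r, s, t} := by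
  intro h
  have hm : ∀ x : ZMod 21, x ∈ ({1, 2, 4, 8, 11, 16} : Finset (ZMod 21)) → IsUnit x := fun x hx =>
    isUnit_of_mem_fermatCMType (r := 1) (s := 4) (t := 16) (by rw [fermatCMType_twentyOne_one_four_sixteen]; exact hx)
  have hne : ({2, 8, 11} : Multiset (ZMod 21)) ≠ {1, 4, 16} := by decide
  exact hne (h 1 4 16 2 8 11 (hm 1 (by decide)) (hm 4 (by decide)) (hm 16 (by decide)) (by decide)
    (hm 2 (by decide)) (hm 8 (by decide)) (hm 11 (by decide)) (by decide) fermatCMType_twentyOne_two_eight_eleven)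

/-- `H_{1,4,16}` modulo `21` does NOT have trivial stabiliser (e.g. `2H = H`). [cite: KoblitzRohrlich1978, §2 Remark 2 (p. 1193)] -/
theorem not_hasTrivialStabilizer_twentyOne : ¬CyclotomicCMTypeResidueSets.HasTrivialStabilizer 21 (fermatCMType 21 1 4 16) := by
  rw [fermatCMType_twentyOne_one_four_sixteen]
  decide

variable {L : Type} [Field L] [NumberField L] [IsCyclotomicExtension {21} ℚ L]

/-- **No abelian variety of type `(ℚ(ζ₂₁); Φ_{(1,4,16)})` is simple** ("`J_{1,4,16}` is isogenous to the product of `6` copies of [an]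
elliptic curve"; typed: non-simplicity, via Shimura §8.2 Prop. 26 = tree `isPrimitive_iff_hasTrivialStabilizer` and §1's stabiliser).
[cite: KoblitzRohrlich1978, §1 (p. 1184) and §2 Remark 2 (p. 1193)] [cite: Shimura1998, §8.2 Prop. 26] -/
theorem not_isSimple_of_fermat_one_four_sixteen
    {hS : ∀ c : ZMod 21, c.val.Coprime 21 → (c ∈ fermatCMType 21 1 4 16 ↔ -c ∉ fermatCMType 21 1 4 16)}
    {A : Motives.AbelianVariety ℂ} {ι : 𝓞 L →+* CategoryTheory.End A} {θ : L →+* Module.End ℂ (complexBetti A.X 1)}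
    (hA : IsCMTypeRealisation (cmTypeOfResidues (L := L) (fermatCMType 21 1 4 16) hS) A ι θ) : ¬A.IsSimple := by
  obtain ⟨φ₀⟩ : Nonempty (L →+* ℂ) := inferInstance
  refine not_isSimple_of_isCMTypeRealisation_of_not_isPrimitive hA φ₀ fun hP => ?_
  rw [CyclotomicCMTypeResidueSets.isPrimitive_iff_hasTrivialStabilizer 21,
    CyclotomicCMTypeResidueSets.residueSet_cmTypeOfResidues 21 (isCMResidueSet_fermatCMType hS)] at hP
  exact not_hasTrivialStabilizer_twentyOne hP

/-- Non-vacuity: `H_{1,4,16}` modulo `21` IS a CM residue set (the hypothesis `hS` above is satisfiable; kernel computation).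
[cite: KoblitzRohrlich1978, §1 (p. 1183)] -/
theorem fermatCMType_twentyOne_cm :
    ∀ c : ZMod 21, c.val.Coprime 21 → (c ∈ fermatCMType 21 1 4 16 ↔ -c ∉ fermatCMType 21 1 4 16) := by
  rw [fermatCMType_twentyOne_one_four_sixteen]
  decide

end TwentyOne

/-! ## §2 `N = 39`: `H_{1,16,22} = W_{1,16,22}` has order `12 = φ(39)/2`; the strong (∗) fails -/

section ThirtyNine

/-- **`H_{1,16,22}` modulo `39`** (`ρ = 16`, `ρ² = 256 ≡ 22`): `H_{1,16,22} = {1, 2, 4, 5, 8, 10, 11, 16, 20, 22, 25, 32}` (kernel computation).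
[cite: KoblitzRohrlich1978, §2 Remark 2 (p. 1193)] -/
theorem fermatCMType_thirtyNine_one_sixteen_twentyTwo :
    fermatCMType 39 1 16 22 = {1, 2, 4, 5, 8, 10, 11, 16, 20, 22, 25, 32} := by
  decide

/-- `H_{2,32,5} = H_{1,16,22}` modulo `39` (`(2, 32, 5) = 2·(1, 16, 22)`; kernel computation). [cite: KoblitzRohrlich1978, §2 Remark 2 (p. 1193)] -/
theorem fermatCMType_thirtyNine_two_thirtyTwo_five : fermatCMType 39 2 32 5 = fermatCMType 39 1 16 22 := by
  decide

/-- **`W_{1,16,22} = H_{1,16,22}` modulo `39`**: a unit `w` satisfies `wH = H` iff `w ∈ H` — `|W_{1,16,22}| = 12 = φ(39)/2`, i.e. EVERY unit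
is `±w` for a `w` with `wH = H` ("`J_{1,16,22}` is isogenous to a product of `12` copies of an elliptic curve": `12·dim = φ(39)/2 = 12`).
Kernel computation. [cite: KoblitzRohrlich1978, §1 (p. 1184) and §2 Remark 2 (p. 1193)] -/
theorem forall_mem_iff_mul_mem_iff_mem_thirtyNine :
    ∀ w : ZMod 39, w.val.Coprime 39 →
      ((∀ x, x ∈ fermatCMType 39 1 16 22 ↔ w * x ∈ fermatCMType 39 1 16 22) ↔ w ∈ fermatCMType 39 1 16 22) := by
  rw [fermatCMType_thirtyNine_one_sixteen_twentyTwo]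
  decide

/-- `|H_{1,16,22}| = |W_{1,16,22}| = 12 = φ(39)/2` modulo `39`. [cite: KoblitzRohrlich1978, §2 Remark 2 (p. 1193)] -/
theorem card_fermatCMType_thirtyNine_one_sixteen_twentyTwo : (fermatCMType 39 1 16 22).card = 12 ∧ Nat.totient 39 = 24 := by
  refine ⟨by rw [fermatCMType_thirtyNine_one_sixteen_twentyTwo]; decide, ?_⟩
  rw [show (39 : ℕ) = 3 * 13 from rfl, Nat.totient_mul (by norm_num), Nat.totient_prime (by norm_num),
    Nat.totient_prime (by norm_num)]

/-- **The strong form of (∗) FAILS at `N = 39`**: unit triples `τ = (1, 16, 22)`, `τ′ = (2, 32, 5)` (sums `0`) have `H_{τ′} = H_τ` but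
`{2, 32, 5} ≠ {1, 16, 22}` (`s(39) = 1/4`: the character-count hypothesis is unavailable). [cite: KoblitzRohrlich1978, §2 Remark 2 (p. 1193)] -/
theorem not_forall_fermatCMType_eq_imp_multiset_eq_thirtyNine :
    ¬∀ r s t r' s' t' : ZMod 39, IsUnit r → IsUnit s → IsUnit t → r + s + t = 0 →
      IsUnit r' → IsUnit s' → IsUnit t' → r' + s' + t' = 0 →
        fermatCMType 39 r' s' t' = fermatCMType 39 r s t → ({r', s', t'} : Multiset (ZMod 39)) = {r, s, t} := by
  intro h
  have hm : ∀ x : ZMod 39, x ∈ ({1, 2, 4, 5, 8, 10, 11, 16, 20, 22, 25, 32} : Finset (ZMod 39)) → IsUnit x := fun x hx =>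
    isUnit_of_mem_fermatCMType (r := 1) (s := 16) (t := 22) (by rw [fermatCMType_thirtyNine_one_sixteen_twentyTwo]; exact hx)
  have hne : ({2, 32, 5} : Multiset (ZMod 39)) ≠ {1, 16, 22} := by decide
  exact hne (h 1 16 22 2 32 5 (hm 1 (by decide)) (hm 16 (by decide)) (hm 22 (by decide)) (by decide)
    (hm 2 (by decide)) (hm 32 (by decide)) (hm 5 (by decide)) (by decide) fermatCMType_thirtyNine_two_thirtyTwo_five)

/-- `H_{1,16,22}` modulo `39` does NOT have trivial stabiliser. [cite: KoblitzRohrlich1978, §2 Remark 2 (p. 1193)] -/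
theorem not_hasTrivialStabilizer_thirtyNine :
    ¬CyclotomicCMTypeResidueSets.HasTrivialStabilizer 39 (fermatCMType 39 1 16 22) := by
  rw [fermatCMType_thirtyNine_one_sixteen_twentyTwo]
  decide

variable {L : Type} [Field L] [NumberField L] [IsCyclotomicExtension {39} ℚ L]

/-- **No abelian variety of type `(ℚ(ζ₃₉); Φ_{(1,16,22)})` is simple** ("isogenous to a product of `12` copies of an elliptic curve";
typed: non-simplicity). [cite: KoblitzRohrlich1978, §1 (p. 1184) and §2 Remark 2 (p. 1193)] [cite: Shimura1998, §8.2 Prop. 26] -/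
theorem not_isSimple_of_fermat_one_sixteen_twentyTwo
    {hS : ∀ c : ZMod 39, c.val.Coprime 39 → (c ∈ fermatCMType 39 1 16 22 ↔ -c ∉ fermatCMType 39 1 16 22)}
    {A : Motives.AbelianVariety ℂ} {ι : 𝓞 L →+* CategoryTheory.End A} {θ : L →+* Module.End ℂ (complexBetti A.X 1)}
    (hA : IsCMTypeRealisation (cmTypeOfResidues (L := L) (fermatCMType 39 1 16 22) hS) A ι θ) : ¬A.IsSimple := by
  obtain ⟨φ₀⟩ : Nonempty (L →+* ℂ) := inferInstance
  refine not_isSimple_of_isCMTypeRealisation_of_not_isPrimitive hA φ₀ fun hP => ?_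
  rw [CyclotomicCMTypeResidueSets.isPrimitive_iff_hasTrivialStabilizer 39,
    CyclotomicCMTypeResidueSets.residueSet_cmTypeOfResidues 39 (isCMResidueSet_fermatCMType hS)] at hP
  exact not_hasTrivialStabilizer_thirtyNine hP

/-- Non-vacuity: `H_{1,16,22}` modulo `39` IS a CM residue set (kernel computation). [cite: KoblitzRohrlich1978, §1 (p. 1183)] -/
theorem fermatCMType_thirtyNine_cm :
    ∀ c : ZMod 39, c.val.Coprime 39 → (c ∈ fermatCMType 39 1 16 22 ↔ -c ∉ fermatCMType 39 1 16 22) := by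
  rw [fermatCMType_thirtyNine_one_sixteen_twentyTwo]
  decide

end ThirtyNine

/-! ## §3 The iff capstones at odd two-prime levels: the hypothesis and the strong (∗) hold iff `N ∉ {21, 39}` -/

section Iff

variable {p q a b N : ℕ} [hp : Fact p.Prime] [hq : Fact q.Prime] [NeZero N]

/-- **REMARK 2 AT TWO-PRIME LEVELS, BOTH DIRECTIONS** ("there are precisely two values of `N` for which `s(N) ≥ 1/6`: `s(21) = 1/6`,
`s(39) = 1/4`"): for an odd two-prime level `N = pᵃqᵇ` (`p ≠ q` odd primes, `a, b ≥ 1`), `12·#S₀(N) < φ(N)` iff `N ∉ {21, 39}`.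
[cite: KoblitzRohrlich1978, §2 Remark 2 (p. 1193) and Proposition (p. 1190)] -/
theorem twelve_mul_card_bad_lt_totient_iff_oddTwoPrimes (hp2 : p ≠ 2) (hq2 : q ≠ 2) (hpq : p ≠ q) (ha : a ≠ 0) (hb : b ≠ 0)
    (hN : N = p ^ a * q ^ b) :
    12 * Nat.card {χ : DirichletCharacter ℂ N // χ.Odd ∧ bernoulliOneChar χ = 0} < N.totient ↔ (N ≠ 21 ∧ N ≠ 39) := by
  constructor
  · intro h
    constructor
    · rintro rfl
      exact not_twelve_mul_card_bad_lt_totient_twentyOne h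
    · rintro rfl
      exact not_twelve_mul_card_bad_lt_totient_thirtyNine h
  · rintro ⟨h21, h39⟩
    exact twelve_mul_card_bad_lt_totient_oddTwoPrimes hp2 hq2 hpq ha hb hN h21 h39

/-- **THE STRONG (∗) AT ODD TWO-PRIME LEVELS, BOTH DIRECTIONS**: for `N = pᵃqᵇ` (`p ≠ q` odd primes, `a, b ≥ 1`), the statement
"`H_{r′,s′,t′} = H_{r,s,t} ⟹ {r′,s′,t′} = {r,s,t}` for all unit triples with `r + s + t = 0 = r′ + s′ + t′`" holds iff `N ∉ {21, 39}`
(`⇐`: the sibling's Theorem 1 (i); `⇒`: the witnesses `2·(1, 4, 16)` mod `21` and `2·(1, 16, 22)` mod `39` of §§1–2).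
[cite: KoblitzRohrlich1978, Theorem 1 (i) (p. 1185) and §2 Remark 2 (p. 1193)] -/
theorem forall_fermatCMType_eq_iff_multiset_eq_iff_oddTwoPrimes (hp2 : p ≠ 2) (hq2 : q ≠ 2) (hpq : p ≠ q) (ha : a ≠ 0)
    (hb : b ≠ 0) (hN : N = p ^ a * q ^ b) :
    (∀ r s t r' s' t' : ZMod N, IsUnit r → IsUnit s → IsUnit t → r + s + t = 0 →
        IsUnit r' → IsUnit s' → IsUnit t' → r' + s' + t' = 0 →
          (fermatCMType N r' s' t' = fermatCMType N r s t ↔ ({r', s', t'} : Multiset (ZMod N)) = {r, s, t})) ↔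
      (N ≠ 21 ∧ N ≠ 39) := by
  constructor
  · intro h
    constructor
    · rintro rfl
      exact not_forall_fermatCMType_eq_imp_multiset_eq_twentyOne fun r s t r' s' t' hr hs ht hrst hr' hs' ht' hrst' =>
        (h r s t r' s' t' hr hs ht hrst hr' hs' ht' hrst').1
    · rintro rfl
      exact not_forall_fermatCMType_eq_imp_multiset_eq_thirtyNine fun r s t r' s' t' hr hs ht hrst hr' hs' ht' hrst' =>
        (h r s t r' s' t' hr hs ht hrst hr' hs' ht' hrst').1
  · rintro ⟨h21, h39⟩ r s t r' s' t' hr hs ht hrst hr' hs' ht' hrst'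
    exact fermatCMType_eq_iff_multiset_eq_oddTwoPrimes hp2 hq2 hpq ha hb hN h21 h39 hr hs ht hrst hr' hs' ht' hrst'

end Iff

end CyclotomicFermatCMType

end Literature.AlgebraicGeometry.ComplexMultiplication
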